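import Summits.QuantumFields.YangMills.Theorems.LangevinControlUVFemtoCurvatureTwoPointCTorusLower
import Summits.QuantumFields.YangMills.Theorems.LangevinControlUVFemtoCurvatureTwoPointCTorusTopLinkSharp
import Summits.QuantumFields.YangMills.Theorems.EquipartitionCriticalityFreeEnergyLogCoefficientStubWeakCoupling
import HarnessLib

/-!
# Route `LangevinControlUV`, crux `FemtoCurvatureTwoPointC` (stmt-QuantumFields-16204), line
# `conditional-covariance-floor` — V-corner, the HYPERPLANE-TWIST background (algebra of the
# holonomy-conditioned Gaussian lower bound)

Infrastructure for the uniform torus doubling on ALL boxes (`uniformDoubling_all` ⇒ UDC ⇒ stub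
V-corner through the landed bridge `varianceCeilingCorner_of_uniformDoublingCorner`). The lower half
of the holonomy-conditioned sandwich (`torus_lower_axisHolonomy`, file `…CTorusLowerAxis`) perturbs,
in the comb gauge of `…CTorusLower`, around the **hyperplane-twist background** of a quadruple
`a : Fin 4 → G`:

  `Ū(a)(x, μ) = a μ` if `x_μ = L − 1` (as naturals: `¬ x_μ + 1 < L`), and `1` otherwise.

This file is the pure algebra of that background (no measure theory):

* `TwistLower.plaquetteHolonomy_twist`, `TwistLower.wilsonAction_twist` — every plaquette of `Ū(a)`
  is the commutator `[a_μ, a_ν]` if its base point lies on both last slices `x_μ = x_ν = L − 1` and is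
  `1` otherwise, so `S(Ū(a)) = L² · f(a)` with the COMMUTATOR COST
  `f(a) = Σ_{μ<ν} (N − Re tr ρ(a_μ a_ν a_μ⁻¹ a_ν⁻¹))` (Wilson's action on `(ℤ/1)⁴`,
  `OneSite.wilsonAction_eq_commutatorCost`); the count `#{x | x_μ = x_ν = L − 1} = L²` is
  `TwistLower.card_filter_lastSlice_pair`;
* `TwistLower.wilsonAction_le_two_mul_add_of_near` — RE-CENTRED Gaussian control: if every link of `U`
  is `δ`-close through the unitary `ρ` to the corresponding link of `V`, then
  `S(U) ≤ 2 S(V) + 16 δ² #P` (each plaquette moves by `≤ 4δ` in Hilbert–Schmidt norm, and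
  `N − Re tr ρ g = ½‖1 − ρ g‖²`, `WeakCoupling.sub_re_trace_eq`), the analogue around `V` of
  `wilsonAction_le_of_ball` (`V = 1`);
* `TwistLower.axis_notMem_combEdges`, `TwistLower.card_inner` — the four AXIS WRAP links
  `a_μ = ((L−1) e_μ, μ)` are off the comb tree, and the remaining ("inner") off-comb links number
  `3L⁴ − 3`.

Everything is proved from Mathlib and landed tree files; no named facts, no definitions (the
background is characterised by the hypothesis `hŪ : ∀ e, Ū e = if (e.1 e.2).val + 1 < L then 1 else a e.2`).
-/

set_option autoImplicit false

noncomputable section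

open scoped Matrix.Norms.Frobenius
open Literature.MathematicalPhysics.QuantumFieldTheory
open Summit.QuantumFields.YangMills.Theorems.FreeEnergyLogCoefficient (WeakCoupling.sub_re_trace_eq)

namespace Summit.QuantumFields.YangMills.Theorems.FemtoCurvatureTwoPointC.TorusGauge

namespace TwistLower

/-! ### Hilbert–Schmidt control of the action around an arbitrary configuration -/

section Near

variable {G : Type*} [Group G] {N : ℕ} (ρ : G →* Matrix (Fin N) (Fin N) ℂ)

/-- `‖ρ(g h) − ρ(g' h')‖ ≤ ‖ρ g − ρ g'‖ + ‖ρ h − ρ h'‖` for a unitary representation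
(`ρ(gh) − ρ(g'h') = ρ g (ρ h − ρ h') + (ρ g − ρ g') ρ h'`, unitary invariance of the Frobenius norm). -/
theorem norm_rho_mul_sub_rho_mul_le (hU : ∀ g, ρ g ∈ Matrix.unitaryGroup (Fin N) ℂ)
    (g h g' h' : G) : ‖ρ (g * h) - ρ (g' * h')‖ ≤ ‖ρ g - ρ g'‖ + ‖ρ h - ρ h'‖ := by
  have e : ρ (g * h) - ρ (g' * h') = ρ g * (ρ h - ρ h') + (ρ g - ρ g') * ρ h' := by
    rw [map_mul, map_mul, Matrix.mul_sub, Matrix.sub_mul]; abel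
  rw [e]
  calc ‖ρ g * (ρ h - ρ h') + (ρ g - ρ g') * ρ h'‖
      ≤ ‖ρ g * (ρ h - ρ h')‖ + ‖(ρ g - ρ g') * ρ h'‖ := norm_add_le _ _
    _ = ‖ρ h - ρ h'‖ + ‖ρ g - ρ g'‖ := by
        rw [Matrix.frobenius_norm_unitaryGroup_mul ⟨ρ g, hU g⟩ (ρ h - ρ h'),
          Matrix.frobenius_norm_mul_unitaryGroup (ρ g - ρ g') ⟨ρ h', hU h'⟩]
    _ = ‖ρ g - ρ g'‖ + ‖ρ h - ρ h'‖ := add_comm _ _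

/-- `‖ρ g⁻¹ − ρ h⁻¹‖ = ‖ρ g − ρ h‖` for a unitary representation
(`ρ g⁻¹ − ρ h⁻¹ = ρ g⁻¹ (ρ h − ρ g) ρ h⁻¹`). -/
theorem norm_rho_inv_sub_rho_inv (hU : ∀ g, ρ g ∈ Matrix.unitaryGroup (Fin N) ℂ) (g h : G) :
    ‖ρ g⁻¹ - ρ h⁻¹‖ = ‖ρ g - ρ h‖ := by
  have h1 : ρ g⁻¹ * ρ g = 1 := by rw [← map_mul, inv_mul_cancel, map_one]
  have h2 : ρ h * ρ h⁻¹ = 1 := by rw [← map_mul, mul_inv_cancel, map_one]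
  have e : ρ g⁻¹ * (ρ h - ρ g) * ρ h⁻¹ = ρ g⁻¹ - ρ h⁻¹ := by
    rw [Matrix.mul_sub, Matrix.sub_mul, mul_assoc _ (ρ h), h2, mul_one, h1, one_mul]
  rw [← e, Matrix.frobenius_norm_mul_unitaryGroup _ ⟨ρ h⁻¹, hU h⁻¹⟩,
    Matrix.frobenius_norm_unitaryGroup_mul ⟨ρ g⁻¹, hU g⁻¹⟩, norm_sub_rev]

/-- If every link of `U` is `δ`-close to the corresponding link of `V` (through the unitary `ρ`),
every plaquette holonomy of `U` is `4δ`-close to that of `V`. -/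
theorem norm_rho_plaquetteHolonomy_sub_le (hU : ∀ g, ρ g ∈ Matrix.unitaryGroup (Fin N) ℂ)
    {L : ℕ} {U V : GaugeConfig 4 L G} {δ : ℝ} (hUV : ∀ e, ‖ρ (U e) - ρ (V e)‖ ≤ δ)
    (x : Site 4 L) (i j : Fin 4) :
    ‖ρ (plaquetteHolonomy U x i j) - ρ (plaquetteHolonomy V x i j)‖ ≤ 4 * δ := by
  unfold plaquetteHolonomy
  calc ‖ρ (U (x, i) * U (x.shift i, j) * (U (x.shift j, i))⁻¹ * (U (x, j))⁻¹) -
        ρ (V (x, i) * V (x.shift i, j) * (V (x.shift j, i))⁻¹ * (V (x, j))⁻¹)‖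
      ≤ ‖ρ (U (x, i) * U (x.shift i, j) * (U (x.shift j, i))⁻¹) -
            ρ (V (x, i) * V (x.shift i, j) * (V (x.shift j, i))⁻¹)‖ +
          ‖ρ (U (x, j))⁻¹ - ρ (V (x, j))⁻¹‖ := norm_rho_mul_sub_rho_mul_le ρ hU _ _ _ _
    _ ≤ ‖ρ (U (x, i) * U (x.shift i, j)) - ρ (V (x, i) * V (x.shift i, j))‖ +
          ‖ρ (U (x.shift j, i))⁻¹ - ρ (V (x.shift j, i))⁻¹‖ + ‖ρ (U (x, j))⁻¹ - ρ (V (x, j))⁻¹‖ := by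
        gcongr
        exact norm_rho_mul_sub_rho_mul_le ρ hU _ _ _ _
    _ ≤ ‖ρ (U (x, i)) - ρ (V (x, i))‖ + ‖ρ (U (x.shift i, j)) - ρ (V (x.shift i, j))‖ +
          ‖ρ (U (x.shift j, i))⁻¹ - ρ (V (x.shift j, i))⁻¹‖ + ‖ρ (U (x, j))⁻¹ - ρ (V (x, j))⁻¹‖ := by
        gcongr
        exact norm_rho_mul_sub_rho_mul_le ρ hU _ _ _ _
    _ ≤ δ + δ + δ + δ := by
        rw [norm_rho_inv_sub_rho_inv ρ hU, norm_rho_inv_sub_rho_inv ρ hU]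
        gcongr <;> exact hUV _
    _ = 4 * δ := by ring

/-- Re-centred plaquette energy bound: `N − Re tr ρ g ≤ 2 (N − Re tr ρ h) + ‖ρ g − ρ h‖²` for a
unitary `ρ` (`N − Re tr ρ = ½‖1 − ρ ·‖²` and `(u + v)² ≤ 2u² + 2v²`). -/
theorem sub_re_trace_le_two_mul_add (hU : ∀ g, ρ g ∈ Matrix.unitaryGroup (Fin N) ℂ) (g h : G) :
    (N : ℝ) - (ρ g).trace.re ≤ 2 * ((N : ℝ) - (ρ h).trace.re) + ‖ρ g - ρ h‖ ^ 2 := by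
  rw [WeakCoupling.sub_re_trace_eq ρ hU g, WeakCoupling.sub_re_trace_eq ρ hU h]
  have htri : ‖1 - ρ g‖ ≤ ‖1 - ρ h‖ + ‖ρ g - ρ h‖ := by
    have e : (1 : Matrix (Fin N) (Fin N) ℂ) - ρ g = (1 - ρ h) - (ρ g - ρ h) := by abel
    rw [e]
    exact norm_sub_le _ _
  have hsq : ‖1 - ρ g‖ ^ 2 ≤ (‖1 - ρ h‖ + ‖ρ g - ρ h‖) ^ 2 :=
    pow_le_pow_left₀ (norm_nonneg _) htri 2
  nlinarith [hsq, sq_nonneg (‖1 - ρ h‖ - ‖ρ g - ρ h‖)]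

/-- **Re-centred Gaussian control of the Wilson action.** If every link of `U` is `δ`-close through
the unitary `ρ` to the corresponding link of `V`, then `S(U) ≤ 2 S(V) + 16 δ² #P`. -/
theorem wilsonAction_le_two_mul_add_of_near (hU : ∀ g, ρ g ∈ Matrix.unitaryGroup (Fin N) ℂ)
    {L : ℕ} [NeZero L] {U V : GaugeConfig 4 L G} {δ : ℝ} (hUV : ∀ e, ‖ρ (U e) - ρ (V e)‖ ≤ δ) :
    wilsonAction ρ U ≤ 2 * wilsonAction ρ V + 16 * δ ^ 2 * Fintype.card (Plaquette 4 L) := by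
  unfold wilsonAction
  rw [Finset.mul_sum]
  calc ∑ p : Plaquette 4 L, ((N : ℝ) - (ρ (plaquetteHolonomy U p.1 p.2.1.1 p.2.1.2)).trace.re)
      ≤ ∑ p : Plaquette 4 L, (2 * ((N : ℝ) - (ρ (plaquetteHolonomy V p.1 p.2.1.1 p.2.1.2)).trace.re) +
          16 * δ ^ 2) := Finset.sum_le_sum fun p _ => by
        have h1 := sub_re_trace_le_two_mul_add ρ hU (plaquetteHolonomy U p.1 p.2.1.1 p.2.1.2)
          (plaquetteHolonomy V p.1 p.2.1.1 p.2.1.2)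
        have h2 := norm_rho_plaquetteHolonomy_sub_le ρ hU hUV p.1 p.2.1.1 p.2.1.2
        have h3 : ‖ρ (plaquetteHolonomy U p.1 p.2.1.1 p.2.1.2) -
            ρ (plaquetteHolonomy V p.1 p.2.1.1 p.2.1.2)‖ ^ 2 ≤ (4 * δ) ^ 2 :=
          pow_le_pow_left₀ (norm_nonneg _) h2 2
        nlinarith [h1, h3]
    _ = ∑ p : Plaquette 4 L, 2 * ((N : ℝ) - (ρ (plaquetteHolonomy V p.1 p.2.1.1 p.2.1.2)).trace.re) +
          16 * δ ^ 2 * Fintype.card (Plaquette 4 L) := by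
        rw [Finset.sum_add_distrib, Finset.sum_const, Finset.card_univ, nsmul_eq_mul]
        ring

end Near

/-! ### The hyperplane-twist background -/

section Twist

variable {L : ℕ} {G : Type*} [Group G]

/-- **Plaquettes of the hyperplane twist.** For the background `Ū(a)` (`a_μ` on the last slice
`x_μ = L − 1`, `1` elsewhere) the plaquette `(x; μ, ν)`, `μ ≠ ν`, has holonomy `[a_μ, a_ν]` if
`x_μ = x_ν = L − 1` and `1` otherwise (the step `x ↦ x + e_μ` does not move the coordinate `ν`). -/
theorem plaquetteHolonomy_twist (a : Fin 4 → G) {Ubar : GaugeConfig 4 L G}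
    (hU : ∀ e : Edge 4 L, Ubar e = if (e.1 e.2).val + 1 < L then 1 else a e.2)
    (x : Site 4 L) {μ ν : Fin 4} (hμν : μ ≠ ν) :
    plaquetteHolonomy Ubar x μ ν = if ¬(x μ).val + 1 < L ∧ ¬(x ν).val + 1 < L then
      a μ * a ν * (a μ)⁻¹ * (a ν)⁻¹ else 1 := by
  unfold plaquetteHolonomy
  simp only [hU, shift_apply_of_ne x hμν.symm, shift_apply_of_ne x hμν]
  by_cases hμ : (x μ).val + 1 < L <;> by_cases hν : (x ν).val + 1 < L <;> simp [hμ, hν]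

/-- **The doubly-last slices have `L²` sites**: `#{x : (ℤ/L)⁴ | x_μ = x_ν = L − 1} = L²` (`μ ≠ ν`). -/
theorem card_filter_lastSlice_pair [NeZero L] {μ ν : Fin 4} (hμν : μ ≠ ν) :
    (Finset.univ.filter fun x : Site 4 L => ¬(x μ).val + 1 < L ∧ ¬(x ν).val + 1 < L).card =
      L ^ 2 := by
  classical
  have hbox : (Finset.univ.filter fun x : Site 4 L => ¬(x μ).val + 1 < L ∧ ¬(x ν).val + 1 < L) =
      Fintype.piFinset fun i => if i = μ ∨ i = ν then
        Finset.univ.filter (fun c : ZMod L => ¬c.val + 1 < L) else Finset.univ := by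
    ext x
    simp only [Finset.mem_filter, Finset.mem_univ, true_and, Fintype.mem_piFinset]
    constructor
    · rintro ⟨h1, h2⟩ i
      split_ifs with hi
      · rcases hi with rfl | rfl
        · exact Finset.mem_filter.2 ⟨Finset.mem_univ _, h1⟩
        · exact Finset.mem_filter.2 ⟨Finset.mem_univ _, h2⟩
      · exact Finset.mem_univ _
    · intro h
      have hμ' := h μ
      have hν' := h ν
      simp only [true_or, or_true, if_true, Finset.mem_filter, Finset.mem_univ, true_and] at hμ' hν'
      exact ⟨hμ', hν'⟩
  rw [hbox, Fintype.card_piFinset]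
  have hslot : ∀ i : Fin 4, ((if i = μ ∨ i = ν then
      Finset.univ.filter (fun c : ZMod L => ¬c.val + 1 < L) else Finset.univ).card) =
        if i = μ ∨ i = ν then 1 else L := fun i => by
    split_ifs
    · exact TopLinkSharp.card_filter_not_val_succ_lt
    · rw [Finset.card_univ, ZMod.card]
  simp_rw [hslot]
  rw [Finset.prod_ite, Finset.prod_const_one, one_mul, Finset.prod_const]
  congr 1
  have hpair : (Finset.univ.filter fun i : Fin 4 => i = μ ∨ i = ν) = {μ, ν} := by
    ext i; simp
  have h := Finset.card_filter_add_card_filter_not (s := (Finset.univ : Finset (Fin 4)))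
    (fun i : Fin 4 => i = μ ∨ i = ν)
  rw [hpair, Finset.card_pair hμν, Finset.card_univ, Fintype.card_fin] at h
  omega

/-- **The action of the hyperplane twist is `L²` times the commutator cost**:
`S(Ū(a)) = L² · Σ_{μ<ν} (N − Re tr ρ(a_μ a_ν a_μ⁻¹ a_ν⁻¹))`. -/
theorem wilsonAction_twist [NeZero L] {N : ℕ} (ρ : G →* Matrix (Fin N) (Fin N) ℂ) (a : Fin 4 → G)
    {Ubar : GaugeConfig 4 L G}
    (hU : ∀ e : Edge 4 L, Ubar e = if (e.1 e.2).val + 1 < L then 1 else a e.2) :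
    wilsonAction ρ Ubar = (L : ℝ) ^ 2 * ∑ q : {q : Fin 4 × Fin 4 // q.1 < q.2},
      ((N : ℝ) - (ρ (a q.1.1 * a q.1.2 * (a q.1.1)⁻¹ * (a q.1.2)⁻¹)).trace.re) := by
  classical
  unfold wilsonAction
  rw [Fintype.sum_prod_type_right, Finset.mul_sum]
  refine Finset.sum_congr rfl fun q _ => ?_
  have hq : q.1.1 ≠ q.1.2 := q.2.ne
  have hcost : ∀ x : Site 4 L,
      ((N : ℝ) - (ρ (plaquetteHolonomy Ubar x q.1.1 q.1.2)).trace.re) =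
        if ¬(x q.1.1).val + 1 < L ∧ ¬(x q.1.2).val + 1 < L then
          ((N : ℝ) - (ρ (a q.1.1 * a q.1.2 * (a q.1.1)⁻¹ * (a q.1.2)⁻¹)).trace.re) else 0 := by
    intro x
    rw [plaquetteHolonomy_twist a hU x hq]
    split_ifs
    · rfl
    · simp [Matrix.trace_one]
  simp_rw [hcost]
  rw [← Finset.sum_filter, Finset.sum_const, card_filter_lastSlice_pair hq, nsmul_eq_mul]
  push_cast
  ring

/-- On the comb tree the hyperplane twist is trivial (comb edges `(x, μ)` have `x_μ ≠ L − 1`). -/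
theorem twist_eq_one_of_mem_combEdges [NeZero L] (a : Fin 4 → G) {Ubar : GaugeConfig 4 L G}
    (hU : ∀ e : Edge 4 L, Ubar e = if (e.1 e.2).val + 1 < L then 1 else a e.2) {e : Edge 4 L}
    (he : e ∈ combEdges L) : Ubar e = 1 := by
  rw [hU, if_pos ((mem_combEdges e).1 he).2]

end Twist

/-! ### The four axis wrap links -/

section Axis

variable {L : ℕ} [NeZero L]

/-- The `μ`-th coordinate of the base point `(L−1) e_μ` of the axis wrap link is the last slice. -/
theorem not_val_axis_succ_lt (μ : Fin 4) :
    ¬((Pi.single μ (((L - 1 : ℕ) : ZMod L)) : Site 4 L) μ).val + 1 < L := by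
  have hL : 0 < L := Nat.pos_of_ne_zero (NeZero.ne L)
  rw [Pi.single_eq_same, ZMod.val_cast_of_lt (by omega)]
  omega

/-- **The axis wrap links are off the comb tree.** -/
theorem axis_notMem_combEdges (μ : Fin 4) :
    ((Pi.single μ (((L - 1 : ℕ) : ZMod L)) : Site 4 L), μ) ∉ combEdges L := fun h =>
  not_val_axis_succ_lt μ ((mem_combEdges _).1 h).2

/-- The hyperplane twist carries `a_μ` on the axis wrap link `μ`. -/
theorem twist_axis {G : Type*} [Group G] (a : Fin 4 → G) {Ubar : GaugeConfig 4 L G}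
    (hU : ∀ e : Edge 4 L, Ubar e = if (e.1 e.2).val + 1 < L then 1 else a e.2) (μ : Fin 4) :
    Ubar ((Pi.single μ (((L - 1 : ℕ) : ZMod L)) : Site 4 L), μ) = a μ := by
  rw [hU, if_neg (not_val_axis_succ_lt μ)]

/-- **The inner off-comb links number `3L⁴ − 3`**: the off-comb links (`3L⁴ + 1` of them,
`card_offComb`) other than the four (distinct) axis wrap links. -/
theorem card_inner :
    (Finset.univ.filter fun i : {e : Edge 4 L // e ∉ combEdges L} =>
      ∀ μ : Fin 4, i.1 ≠ ((Pi.single μ (((L - 1 : ℕ) : ZMod L)) : Site 4 L), μ)).card =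
      3 * L ^ 4 - 3 := by
  classical
  -- the four axis links, as elements of the off-comb subtype
  set ax : Fin 4 → {e : Edge 4 L // e ∉ combEdges L} :=
    fun μ => ⟨((Pi.single μ (((L - 1 : ℕ) : ZMod L)) : Site 4 L), μ), axis_notMem_combEdges μ⟩
    with hax
  have hax_inj : Function.Injective ax := fun μ ν h => by
    have := congrArg (fun i : {e : Edge 4 L // e ∉ combEdges L} => i.1.2) h
    exact this
  have hT : (Finset.univ.filter fun i : {e : Edge 4 L // e ∉ combEdges L} =>
      ¬ ∀ μ : Fin 4, i.1 ≠ ((Pi.single μ (((L - 1 : ℕ) : ZMod L)) : Site 4 L), μ)) =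
        Finset.univ.image ax := by
    ext i
    simp only [Finset.mem_filter, Finset.mem_univ, true_and, Finset.mem_image, not_forall,
      not_not]
    constructor
    · rintro ⟨μ, hμ⟩
      exact ⟨μ, Subtype.ext hμ.symm⟩
    · rintro ⟨μ, hμ⟩
      exact ⟨μ, by rw [← hμ]⟩
  have hcount := Finset.card_filter_add_card_filter_not
    (s := (Finset.univ : Finset {e : Edge 4 L // e ∉ combEdges L}))
    (fun i => ∀ μ : Fin 4, i.1 ≠ ((Pi.single μ (((L - 1 : ℕ) : ZMod L)) : Site 4 L), μ))
  rw [hT, Finset.card_image_of_injective _ hax_inj, Finset.card_univ, Finset.card_univ,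
    Fintype.card_fin, card_offComb] at hcount
  omega

end Axis

end TwistLower

/-! ### The registered statement -/

/-- **The action of the hyperplane twist is `L²` times the commutator cost** (registered sub-goal
`hyperplaneTwist_action` of line `conditional-covariance-floor`, V-corner attack; the signature
verbatim): for every group `G`, matrix representation `ρ`, torus `(ℤ/L)⁴` and quadruple
`a : Fin 4 → G`, the configuration `Ū(a)` carrying `a_μ` on the last slice `x_μ = L − 1` of every
direction `μ` and `1` elsewhere has Wilson action
`S(Ū(a)) = L² · Σ_{μ<ν} (N − Re tr ρ(a_μ a_ν a_μ⁻¹ a_ν⁻¹))` — only the `L²` plaquettes `(x; μ, ν)` with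
`x_μ = x_ν = L − 1` are non-trivial, each equal to the commutator `[a_μ, a_ν]`
(`TwistLower.wilsonAction_twist`). -/
theorem hyperplaneTwist_action :
    ∀ {G : Type} [Group G] {N : ℕ} (ρ : G →* Matrix (Fin N) (Fin N) ℂ) {L : ℕ} [NeZero L]
      (a : Fin 4 → G) (Ubar : GaugeConfig 4 L G),
      (∀ e : Edge 4 L, Ubar e = if (e.1 e.2).val + 1 < L then 1 else a e.2) →
      wilsonAction ρ Ubar = (L : ℝ) ^ 2 * ∑ q : {q : Fin 4 × Fin 4 // q.1 < q.2},
        ((N : ℝ) - (ρ (a q.1.1 * a q.1.2 * (a q.1.1)⁻¹ * (a q.1.2)⁻¹)).trace.re) :=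
  fun ρ _ _ a _ hU => TwistLower.wilsonAction_twist ρ a hU


end Summit.QuantumFields.YangMills.Theorems.FemtoCurvatureTwoPointC.TorusGauge

end
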